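import Mathlib
import HarnessLib
import Literature.AlgebraicGeometry.Motives.Differentials
import Literature.AlgebraicGeometry.HodgeTheory.ComplexGysin
import Literature.AlgebraicGeometry.HodgeTheory.HodgeFiltration
import Literature.AlgebraicGeometry.HodgeTheory.HodgeConjecture
import Literature.Geometry.Kaehler.HolomorphicChartForms
import Literature.AlgebraicGeometry.Surfaces.K3Surface
import Literature.AlgebraicGeometry.Motives.FamiliesVHS

/-!
# Sketch — crux-ideate round 1, ideator 3, crux `HodgeSimilitudeAlgebraic` (stmt-HodgeConjecture-13676)

First lemmas of the three idea cards (they need not be proved; they must elaborate):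

* `SimAlgAt r` — the crux body at a fixed multiplier (the crux is `∀ r > 0, SimAlgAt r`, `Iff.rfl`).
* card `gauss-sum-norm-anchors`: `GaussSumSimilitude` (pure algebra, Mathlib) and `GaussSumAnchor`
  (its geometric form on a K3 with a non-symplectic automorphism of odd prime order).
* card `kulikov-cusp-elliptic-isogeny`: `CurveHodgeMorphismAlgebraic` (the cusp anchor: Hodge
  morphisms between `H¹` of curves are algebraic — Lefschetz (1,1) on `E × E'`).
* card `reduced-dt4-twin-count`: `TwinClassVariational` (what a non-zero reduced Oh–Thomas /
  Bae–Kool–Park cycle delivers: the variational Hodge statement over curves of twin pairs).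
-/

open CategoryTheory
open scoped Manifold
open Literature.AlgebraicGeometry Literature.AlgebraicGeometry.HodgeTheory
open Literature.AlgebraicGeometry.Motives
open Literature.AlgebraicTopology.SingularHomology

noncomputable section

namespace Summit.HodgeConjecture.HodgeConjecture.Cruxes.HodgeSimilitudeAlgebraic.Ideas

/-- The crux body at ONE multiplier `r`: every rational, type-preserving `r`-similitude
`ψ : H²(S'(ℂ);ℂ) → H²(S(ℂ);ℂ)` between projective K3 surfaces is `[γ]_*` for an algebraic `γ`. -/
def SimAlgAt (r : ℚ) : Prop :=
  ∀ (μ : Literature.AlgebraicGeometry.HodgeTheory.OrientationFamily), μ.HasPoincareDuality → ∀ (S S' : Literature.AlgebraicGeometry.Motives.SchemeOver ℂ) (hS : (Literature.AlgebraicGeometry.Motives.IsSmoothProjective 2 S ∧ Subsingleton (Literature.AlgebraicGeometry.Motives.structureSheafCohomology S.left 1) ∧ ∃ (A : Literature.AlgebraicGeometry.HodgeTheory.HodgeModel 2 S) (η : Literature.Geometry.Kaehler.MForm 𝓘(ℝ, A.model) A.carrier ℂ 2), Literature.Geometry.Kaehler.IsHolomorphicInCharts η ∧ ∀ x, η x ≠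 0)) (hS' : (Literature.AlgebraicGeometry.Motives.IsSmoothProjective 2 S' ∧ Subsingleton (Literature.AlgebraicGeometry.Motives.structureSheafCohomology S'.left 1) ∧ ∃ (A : Literature.AlgebraicGeometry.HodgeTheory.HodgeModel 2 S') (η : Literature.Geometry.Kaehler.MForm 𝓘(ℝ, A.model) A.carrier ℂ 2), Literature.Geometry.Kaehler.IsHolomorphicInCharts η ∧ ∀ x, η x ≠ 0)) (p : Literature.AlgebraicGeometry.HodgeTheory.complexBetti S (2 * 2)) (p' : Literature.AlgebraicGeometry.HodgeTheory.complexBetti S' (2 * 2)), (Literature.AlgebraicGeometry.HodgeTheory.IsIntegralClass p ∧ ∀ q : Literature.AlgebraicGeometry.HodgeTheory.complexBetti S (2 * 2), Literature.AlgebraicGeometry.HodgeTheory.IsIntegralClass q → ∃ n : ℤ, q = n • p) → (Literature.AlgebraicGeometry.HodgeTheory.IsIntegralClass p' ∧ ∀ q : Literature.AlgebraicGeometry.HodgeTheory.complexBetti S' (2 * 2), Literature.AlgebraicGeometry.HodgeTheory.IsIntegralClass q → ∃ n : ℤ, q = n • p') → ∀ (ψ : Literature.AlgebraicGeometry.HodgeTheory.complexBetti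 S' (2 * 1) →ₗ[ℂ] Literature.AlgebraicGeometry.HodgeTheory.complexBetti S (2 * 1)), (∀ x, Literature.AlgebraicGeometry.HodgeTheory.IsRationalClass x → Literature.AlgebraicGeometry.HodgeTheory.IsRationalClass (ψ x)) → (∀ (i j : ℕ) x, Literature.AlgebraicGeometry.HodgeTheory.IsOfHodgeType 2 S' (2 * 1) i j x → Literature.AlgebraicGeometry.HodgeTheory.IsOfHodgeType 2 S (2 * 1) i j (ψ x)) → (∀ (x y : Literature.AlgebraicGeometry.HodgeTheory.complexBetti S' (2 * 1)) (a : ℂ), Literature.AlgebraicTopology.SingularHomology.cupProduct (rfl : 2 * 1 + 2 * 1 = 2 * 2) x y = a • p' → Literature.AlgebraicTopology.SingularHomology.cupProduct (rfl : 2 * 1 + 2 * 1 = 2 * 2) (ψ x) (ψ y) = ((r : ℂ) * a) • p) → ∃ γ ∈ Literature.AlgebraicGeometry.HodgeTheory.algebraicClasses (CategoryTheory.MonoidalCategoryStruct.tensorObj S S') 2, ∀ x : Literature.AlgebraicGeometry.HodgeTheory.complexBetti S' (2 * 1), ψ x = Literature.AlgebraicGeometry.HodgeTheory.complexGysin μ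 (Literature.AlgebraicGeometry.Motives.IsSmoothProjective.tensor_holds hS.1 hS'.1) hS.1 (CategoryTheory.SemiCartesianMonoidalCategory.fst S S') (rfl : 2 * 1 + 2 * 2 + 2 * 2 = 2 * 1 + 2 * (2 + 2)) (Literature.AlgebraicTopology.SingularHomology.cupProduct (rfl : 2 * 1 + 2 * 2 = 2 * 1 + 2 * 2) (Literature.AlgebraicGeometry.HodgeTheory.complexBetti.map (CategoryTheory.SemiCartesianMonoidalCategory.snd S S') (2 * 1) x) γ)

/- The crux is literally `∀ r > 0, SimAlgAt r`: in the folder's `Sketch.lean` (which imports the route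
file) `theorem hodgeSimilitudeAlgebraic_iff : HodgeSimilitudeAlgebraic ↔ ∀ r : ℚ, 0 < r → SimAlgAt r := Iff.rfl`
checks (lean check rc 0). This published copy imports only Literature modules so that it elaborates
independently of the route file's build state. -/

/-! ## Card `gauss-sum-norm-anchors` -/

/-- **First lemma (algebraic core).** If `T` is an isometry of a bilinear form `B` whose minimal
polynomial divides the `p`-th cyclotomic polynomial (`1 + T + ⋯ + T^{p-1} = 0`, `p` an odd prime),
then the quadratic Gauss sum `G = ∑ₐ (a/p) Tᵃ` is a `p`-SIMILITUDE of `B`: `Gᵀ B G = p B`.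
(Proof sketch: on the `ζᵏ`-eigenspace `G = (k/p)·g`, `g² = p* = (−1/p)p`, `Gᵀ B G = (−1/p) G² B`-type
computation; Mathlib: `gaussSum`, `legendreSym`.) -/
def GaussSumSimilitude : Prop :=
  ∀ (p : ℕ) [Fact p.Prime], p ≠ 2 → ∀ (n : ℕ) (B T : Matrix (Fin n) (Fin n) ℚ),
    T.transpose * B * T = B → (∑ a ∈ Finset.range p, T ^ a) = 0 →
    (∑ a ∈ Finset.range p, ((legendreSym p a : ℤ) : ℚ) • T ^ a).transpose * B *
        (∑ a ∈ Finset.range p, ((legendreSym p a : ℤ) : ℚ) • T ^ a) = (p : ℚ) • B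

/-- **First lemma (geometric form): the Gauss-sum anchor.** For a projective K3 surface `S`, an
automorphism `τ` and an odd prime `p` such that `τ*` acts on `NS(S)^⊥ ⊆ H²(S(ℂ);ℂ)` through the
`p`-th cyclotomic polynomial (`τ` non-symplectic of order `p`), the Gauss sum
`G = ∑ₐ (a/p) (τ*)ᵃ` is (i) a `p`-similitude on `NS(S)^⊥` and (ii) induced there by an ALGEBRAIC
class of codimension 2 on `S × S` (a signed sum of graphs of automorphisms composed with the
algebraic projector onto `NS^⊥`). This is an unconditional anchor of multiplier `p` for
`p ∈ {3,5,7,11,13,17,19}` (the prime orders of non-symplectic automorphisms of K3 surfaces). -/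
def GaussSumAnchor : Prop :=
  ∀ (μ : OrientationFamily), μ.HasPoincareDuality →
  ∀ (p : ℕ) [Fact p.Prime], p ≠ 2 →
  ∀ (S : SchemeOver ℂ) (hS : Literature.AlgebraicGeometry.Surfaces.IsK3Surface S) (τ : S ≅ S)
    (q : complexBetti S (2 * 2)),
    (IsIntegralClass q ∧ ∀ q' : complexBetti S (2 * 2), IsIntegralClass q' → ∃ n : ℤ, q' = n • q) →
    (∀ x : complexBetti S (2 * 1),
      (∀ d ∈ algebraicClasses S 1, cupProduct (rfl : 2 * 1 + 2 * 1 = 2 * 2) x d = 0) →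
      (∑ a ∈ Finset.range p, ((complexBetti.map τ.hom (2 * 1)).hom ^ a)) x = 0) →
    let G : complexBetti S (2 * 1) →ₗ[ℂ] complexBetti S (2 * 1) :=
      ∑ a ∈ Finset.range p, ((legendreSym p a : ℤ) : ℂ) • ((complexBetti.map τ.hom (2 * 1)).hom ^ a)
    (∀ (x y : complexBetti S (2 * 1)) (c : ℂ),
        (∀ d ∈ algebraicClasses S 1, cupProduct (rfl : 2 * 1 + 2 * 1 = 2 * 2) x d = 0) →
        (∀ d ∈ algebraicClasses S 1, cupProduct (rfl : 2 * 1 + 2 * 1 = 2 * 2) y d = 0) →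
        cupProduct (rfl : 2 * 1 + 2 * 1 = 2 * 2) x y = c • q →
        cupProduct (rfl : 2 * 1 + 2 * 1 = 2 * 2) (G x) (G y) = ((p : ℂ) * c) • q) ∧
    ∃ γ ∈ algebraicClasses (MonoidalCategoryStruct.tensorObj S S) 2, ∀ x : complexBetti S (2 * 1),
        (∀ d ∈ algebraicClasses S 1, cupProduct (rfl : 2 * 1 + 2 * 1 = 2 * 2) x d = 0) →
        G x = complexGysin μ (IsSmoothProjective.tensor_holds hS.1 hS.1) hS.1
              (SemiCartesianMonoidalCategory.fst S S)
              (rfl : 2 * 1 + 2 * 2 + 2 * 2 = 2 * 1 + 2 * (2 + 2))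
              (cupProduct (rfl : 2 * 1 + 2 * 2 = 2 * 1 + 2 * 2)
                (complexBetti.map (SemiCartesianMonoidalCategory.snd S S) (2 * 1) x) γ)

/-! ## Card `kulikov-cusp-elliptic-isogeny` -/

/-- **First lemma (the cusp anchor).** Every rational, type-preserving `ψ : H¹(E'(ℂ);ℂ) → H¹(E(ℂ);ℂ)`
between smooth projective curves is induced by an algebraic class of codimension 1 on `E × E'`
(Künneth + Lefschetz (1,1) on the surface `E × E'`; for elliptic curves: `ψ` is a rational multiple
of `φ*` for an isogeny `φ`, and a `p`-similitude for the polarisation forms has `deg φ ≡ p` mod squares). -/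
def CurveHodgeMorphismAlgebraic : Prop :=
  ∀ (μ : OrientationFamily), μ.HasPoincareDuality →
  ∀ (E E' : SchemeOver ℂ) (hE : IsSmoothProjective 1 E) (hE' : IsSmoothProjective 1 E')
    (ψ : complexBetti E' 1 →ₗ[ℂ] complexBetti E 1),
    (∀ x, IsRationalClass x → IsRationalClass (ψ x)) →
    (∀ (i j : ℕ) x, IsOfHodgeType 1 E' 1 i j x → IsOfHodgeType 1 E 1 i j (ψ x)) →
    ∃ γ ∈ algebraicClasses (MonoidalCategoryStruct.tensorObj E E') 1, ∀ x : complexBetti E' 1,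
      ψ x = complexGysin μ (IsSmoothProjective.tensor_holds hE hE') hE
              (SemiCartesianMonoidalCategory.fst E E')
              (rfl : 1 + 2 * 1 + 2 * 1 = 1 + 2 * (1 + 1))
              (cupProduct (rfl : 1 + 2 * 1 = 1 + 2 * 1)
                (complexBetti.map (SemiCartesianMonoidalCategory.snd E E') 1 x) γ)


/-- **Second lemma of the cusp card (all components of the degenerate product satisfy HC).** For smooth
projective surfaces `V`, `V'` with `p_g = h²(𝒪) = 0` (rational surfaces, elliptic ruled surfaces — the
components of a Kulikov type II model — but also bielliptic surfaces), the Hodge conjecture holds for the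
fourfold `V × V'`: `H² ⊗ H²` is algebraic ⊗ algebraic (Lefschetz (1,1) twice), and the classes in
`H¹ ⊗ H³ ⊕ H³ ⊗ H¹` are homomorphisms of Albanese varieties transported by the (algebraic) Lefschetz
operator of a surface. At a type II cusp of the twin correspondence these components carry the whole
limit of the similitude class, its weight-one residue being an ISOGENY `E' → E` of degree `p·□`. -/
def CuspComponentsHodge : Prop :=
  ∀ (V V' : SchemeOver ℂ), IsSmoothProjective 2 V → IsSmoothProjective 2 V' →
    Subsingleton (structureSheafCohomology V.left 2) → Subsingleton (structureSheafCohomology V'.left 2) →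
    HodgeConjectureFor 4 (MonoidalCategoryStruct.tensorObj V V')

/-! ## Card `reduced-dt4-twin-count` -/

/-- **First lemma (what a non-zero reduced virtual cycle delivers).** Variational Hodge over smooth
projective curves for degree-4 classes on families all of whose fibres are products of two K3
surfaces: a global rational class that is of type (2,2) on every fibre and algebraic on ONE fibre is
algebraic on every fibre. (Bae–Kool–Park, arXiv:2208.09474 Thm 1.13/1.15, give exactly this for a
class carrying a non-zero reduced Oh–Thomas cycle; the card's bet is non-vanishing for the twin
class `m·graph(Ψ_p)` at a Gauss-sum / Nikulin anchor.) -/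
def TwinClassVariational : Prop :=
  ∀ (𝒳 C : SchemeOver ℂ) (f : 𝒳 ⟶ C), IsSmoothProjective 1 C → IsSmoothProjectiveFamily f 4 →
    (∀ t : AlgPoints C ℂ, ∃ (S S' : SchemeOver ℂ),
        Literature.AlgebraicGeometry.Surfaces.IsK3Surface S ∧
        Literature.AlgebraicGeometry.Surfaces.IsK3Surface S' ∧
        Nonempty (fiberOver f t ≅ MonoidalCategoryStruct.tensorObj S S')) →
    ∀ ξ : complexBetti 𝒳 (2 * 2), IsRationalClass ξ →
      (∀ t : AlgPoints C ℂ,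
        IsOfHodgeType 4 (fiberOver f t) (2 * 2) 2 2 ((complexBetti.map (fiberι f t) (2 * 2)).hom ξ)) →
      (∃ o : AlgPoints C ℂ,
        (complexBetti.map (fiberι f o) (2 * 2)).hom ξ ∈ algebraicClasses (fiberOver f o) 2) →
      ∀ t : AlgPoints C ℂ,
        (complexBetti.map (fiberι f t) (2 * 2)).hom ξ ∈ algebraicClasses (fiberOver f t) 2

end Summit.HodgeConjecture.HodgeConjecture.Cruxes.HodgeSimilitudeAlgebraic.Ideas
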